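import Summits.Schanuel.Schanuel.Theorems.ZilberEacAnalyticPuiseuxTools
import HarnessLib

/-!
# Arbitrary base branches, XC (b): THE ANALYTIC NEWTON–PUISEUX THEOREM — a polynomial with ANALYTIC
# rows has a convergent Puiseux root (monic core), by truncation to the polynomial theorem and a
# Newton–Hensel step

HONEST FRAMING.  Cell `pub-schanuel` (Zilber's Exponential-Algebraic Closedness, case ladder;
host summit Schanuel), seat 2, gen 33.  The germ theorems of gens 31–32 (bounded places, file
LXVII; unbounded places of curves over `ℚ̄`, file LXXXIII) decide Mantova–Masser's density question
for any irreducible surface containing a germ `(x₀(s), x₁(s), ψ(s)s^L, e^{x₁(s)})` over a place of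
the base curve.  For a surface fibred in CURVES `{x ∈ C, P(x; y₀) = 0}` the fibre coordinate `y₀`
along the place is a root of a polynomial whose rows are ANALYTIC germs of the place parameter —
this needs the Newton–Puiseux theorem over convergent power series, which gen 26 proved only for
POLYNOMIAL rows (`exists_zeroBranch_puiseux`, Newton polygon, no power series).  This file proves
the analytic case WITHOUT redoing the Newton polygon:
**`exists_puiseuxRoot_monic_analyticRows`** — `R(s, w) = w^d + Σ_{j<d} Q_j(s) w^j` (`d ≥ 1`, `Q_j`
analytic at `0`) with a Bézout element `A R + B ∂_wR = r(s)`, `r ≢ 0` (analytic rows): there are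
`e ≥ 1` and `w` analytic at `0` with `R(σ^e, w(σ)) = 0` for small `σ ≠ 0`.  Proof: `θ` a root of
`R(0, ·)`; TRUNCATE the rows at order `N = 2·ord₀ r + 1` (Taylor, Mathlib) — a monic
`R₀ ∈ ℂ[s][w]`; an irreducible factor of `R₀(s, θ + t)` through the origin has a zero branch
`s = σ^e`, `t = η(σ)` (gen 26); along `z = θ + η` the value `c = R(σ^e, z) = O(σ^{eN})` while the
Bézout identity forces `D = ∂_wR(σ^e, z) = σ^a D₁`, `D₁(0) ≠ 0`, `a ≤ e·ord₀ r`; so `c = D²σ·c₂`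
with `c₂` analytic and the ansatz `w = z + Dσu` turns `R = 0` into `c₂ + u + σ(…) = 0`, solved by
the analytic implicit function theorem (NEWTON–HENSEL).  [folklore (Newton 1676, Puiseux 1850;
the Hensel step: Tougeron's implicit function theorem), made concrete]; nothing here is specific
to Schanuel's conjecture (neither used nor implied); Mantova–Masser's question (PLMS 2024 §1
p. 5) and EC(3,2) stay OPEN; EAC ⇏ SC.
-/

noncomputable section

open Filter Topology Polynomial
open scoped ContDiff

set_option linter.dupNamespace false

namespace Summit.Schanuel.Schanuel.Theorems

/-! ## Part D. The monic core theorem -/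

/-- **The analytic Newton–Puiseux theorem (monic core).**  `R(s, w) = Σ_{j ≤ d} Q_j(s) w^j` with
`Q_j` analytic at `0`, `Q_d ≡ 1`, `d ≥ 1`, and a Bézout element with analytic rows
`A(s, w)R + B(s, w)∂_wR = r(s)` (`r ≢ 0`) on a punctured neighbourhood of `s = 0`: there are
`e ≥ 1` and `w` analytic at `0` with `R(σ^e, w(σ)) = 0` near `σ = 0`.  See the module docstring for
the proof (truncation to gen 26's polynomial Newton–Puiseux theorem + a Newton–Hensel step).
[folklore (Newton–Puiseux over convergent power series), made concrete] (new in this form) -/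
theorem exists_puiseuxRoot_monic_analyticRows (d : ℕ) (hd : 1 ≤ d) (Q : ℕ → ℂ → ℂ)
    (hQan : ∀ j, AnalyticAt ℂ (Q j) 0) (hQd : ∀ s, Q d s = 1)
    (dA : ℕ) (A B : ℕ → ℂ → ℂ) (hAan : ∀ j, AnalyticAt ℂ (A j) 0)
    (hBan : ∀ j, AnalyticAt ℂ (B j) 0) (r : ℂ → ℂ) (hr : AnalyticAt ℂ r 0)
    (hr0 : ¬ ∀ᶠ s in 𝓝 (0 : ℂ), r s = 0)
    (hbez : ∀ᶠ s in 𝓝[≠] (0 : ℂ), ∀ y : ℂ,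
      (∑ i ∈ Finset.range (dA + 1), A i s * y ^ i) *
          (∑ j ∈ Finset.range (d + 1), Q j s * y ^ j) +
        (∑ i ∈ Finset.range (dA + 1), B i s * y ^ i) *
          (∑ j ∈ Finset.range (d + 1), (j : ℂ) * Q j s * y ^ (j - 1)) = r s) :
    ∃ (e : ℕ) (w : ℂ → ℂ), 1 ≤ e ∧ AnalyticAt ℂ w 0 ∧
      ∀ᶠ σ in 𝓝 (0 : ℂ), ∑ j ∈ Finset.range (d + 1), Q j (σ ^ e) * w σ ^ j = 0 := by
  classical
  /- Step 0: `r = s^ρ r₁`, `r₁(0) ≠ 0`. -/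
  obtain ⟨ρ, r₁, hr₁an, hr₁0, hrfac⟩ := exists_eq_pow_mul_of_not_eventually_zero hr hr0
  /- Step 1: truncation of the rows at order `N = 2ρ + 1`. -/
  set N : ℕ := 2 * ρ + 1 with hN
  have htr : ∀ j, ∃ F : ℂ → ℂ, AnalyticAt ℂ F 0 ∧ ∀ z, Q j z =
      (∑ i ∈ Finset.range N, (z ^ i / (i.factorial : ℂ)) • iteratedDeriv i (Q j) 0) + z ^ N • F z :=
    fun j => (hQan j).exists_eq_sum_add_pow_mul N
  choose Fr hFran hFr using htr
  set q : ℕ → ℂ[X] := fun j => ∑ i ∈ Finset.range N,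
    Polynomial.C (iteratedDeriv i (Q j) 0 / (i.factorial : ℂ)) * Polynomial.X ^ i with hq
  have hqeval : ∀ j z, (q j).eval z =
      ∑ i ∈ Finset.range N, (z ^ i / (i.factorial : ℂ)) • iteratedDeriv i (Q j) 0 := by
    intro j z
    simp only [hq, Polynomial.eval_finsetSum, Polynomial.eval_mul, Polynomial.eval_C,
      Polynomial.eval_pow, Polynomial.eval_X, smul_eq_mul]
    refine Finset.sum_congr rfl fun i _ => ?_
    ring
  have hQsplit : ∀ j z, Q j z = (q j).eval z + z ^ N * Fr j z := by
    intro j z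
    rw [hqeval, ← smul_eq_mul]
    exact hFr j z
  /- the truncated polynomial `R₀ = w^d + Σ_{j<d} q_j(s) w^j ∈ ℂ[s][w]` -/
  set R₀ : ℂ[X][X] := Polynomial.X ^ d +
    ∑ j ∈ Finset.range d, Polynomial.C (q j) * Polynomial.X ^ j with hR₀
  have hlow : (∑ j ∈ Finset.range d, Polynomial.C (q j) * Polynomial.X ^ j : ℂ[X][X]).degree < d := by
    rw [← Fin.sum_univ_eq_sum_range (fun j => Polynomial.C (q j) * Polynomial.X ^ j)]
    exact Polynomial.degree_sum_fin_lt _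
  have hR₀monic : R₀.Monic := Polynomial.monic_X_pow_add hlow
  have hR₀nat : R₀.natDegree = d := by
    have h1 : R₀.degree = (d : WithBot ℕ) := by
      rw [hR₀, Polynomial.degree_add_eq_left_of_degree_lt, Polynomial.degree_X_pow]
      rwa [Polynomial.degree_X_pow]
    exact Polynomial.natDegree_eq_of_degree_eq_some h1
  have hR₀eval : ∀ s y : ℂ, (R₀.map (Polynomial.evalRingHom s)).eval y =
      y ^ d + ∑ j ∈ Finset.range d, (q j).eval s * y ^ j := by
    intro s y
    rw [hR₀, Polynomial.map_add, Polynomial.map_pow, Polynomial.map_X, Polynomial.map_sum,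
      Polynomial.eval_add, Polynomial.eval_pow, Polynomial.eval_X, Polynomial.eval_finsetSum]
    simp only [Polynomial.map_mul, Polynomial.map_C, Polynomial.map_pow, Polynomial.map_X,
      Polynomial.eval_mul, Polynomial.eval_C, Polynomial.eval_pow, Polynomial.eval_X,
      Polynomial.coe_evalRingHom]
  -- `R(s, y) = R₀(s, y) + s^N Σ_{j<d} Fr_j(s) y^j`
  have hRsplit : ∀ s y : ℂ, ∑ j ∈ Finset.range (d + 1), Q j s * y ^ j =
      (R₀.map (Polynomial.evalRingHom s)).eval y + s ^ N * ∑ j ∈ Finset.range d, Fr j s * y ^ j := by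
    intro s y
    rw [Finset.sum_range_succ, hQd, one_mul, hR₀eval, Finset.mul_sum]
    have h1 : ∑ j ∈ Finset.range d, Q j s * y ^ j =
        ∑ j ∈ Finset.range d, ((q j).eval s * y ^ j + s ^ N * (Fr j s * y ^ j)) := by
      refine Finset.sum_congr rfl fun j _ => ?_
      rw [hQsplit]; ring
    rw [h1, Finset.sum_add_distrib]
    ring
  /- Step 2: a root `θ` of `R(0, ·) = R₀(0, ·)` and the translated polynomial. -/
  have hmon0 : (R₀.map (Polynomial.evalRingHom 0)).Monic := hR₀monic.map _
  have hdeg0 : 0 < (R₀.map (Polynomial.evalRingHom 0)).degree := by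
    rw [Polynomial.degree_eq_natDegree hmon0.ne_zero, hR₀monic.natDegree_map, hR₀nat]
    exact_mod_cast hd
  obtain ⟨θ, hθ⟩ := Complex.exists_root hdeg0
  set R₀θ : ℂ[X][X] := R₀.comp (Polynomial.X + Polynomial.C (Polynomial.C θ)) with hR₀θ
  have hθmonic : R₀θ.Monic := hR₀monic.comp_X_add_C _
  have hθeval : ∀ s t : ℂ, (R₀θ.map (Polynomial.evalRingHom s)).eval t =
      (R₀.map (Polynomial.evalRingHom s)).eval (t + θ) := by
    intro s t
    rw [hR₀θ, Polynomial.map_comp, Polynomial.eval_comp, Polynomial.map_add, Polynomial.map_X,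
      Polynomial.map_C, Polynomial.eval_add, Polynomial.eval_X, Polynomial.eval_C,
      Polynomial.coe_evalRingHom, Polynomial.eval_C]
  have hθev0 : ∀ s : ℂ, (R₀θ.map (Polynomial.evalRingHom s)).eval 0 = (R₀θ.coeff 0).eval s := by
    intro s
    rw [← Polynomial.coeff_zero_eq_eval_zero (p := R₀θ.map _), Polynomial.coeff_map,
      Polynomial.coe_evalRingHom]
  have hθ00 : (R₀θ.coeff 0).IsRoot 0 := by
    rw [Polynomial.IsRoot, ← hθev0, hθeval, zero_add]
    exact hθ
  /- Step 3: an analytic approximate root `z`: `R₀(σ^e, z(σ)) = 0`. -/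
  obtain ⟨e, z, he, hzan, hR₀z⟩ : ∃ (e : ℕ) (z : ℂ → ℂ), 1 ≤ e ∧ AnalyticAt ℂ z 0 ∧
      ∀ᶠ σ in 𝓝 (0 : ℂ), (R₀.map (Polynomial.evalRingHom (σ ^ e))).eval (z σ) = 0 := by
    by_cases hc0 : R₀θ.coeff 0 = 0
    · refine ⟨1, fun _ => θ, le_rfl, analyticAt_const, Filter.Eventually.of_forall fun σ => ?_⟩
      have h1 : (R₀θ.map (Polynomial.evalRingHom (σ ^ 1))).eval 0 = 0 := by
        rw [hθev0, hc0, Polynomial.eval_zero]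
      rwa [hθeval, zero_add] at h1
    · obtain ⟨Q₁, hirr, hdvd, hnd, hc0', hroot0⟩ :=
        exists_irreducible_factor_root_zero R₀θ hθmonic hc0 hθ00
      obtain ⟨e, η, he, hηan, -, -, hηroot⟩ := exists_zeroBranch_puiseux Q₁ hirr hnd hc0' hroot0
      refine ⟨e, fun σ => η σ + θ, he, hηan.add analyticAt_const, ?_⟩
      obtain ⟨H, hH⟩ := hdvd
      filter_upwards [hηroot] with σ hσ
      rw [zero_add] at hσ
      have h1 : (R₀θ.map (Polynomial.evalRingHom (σ ^ e))).eval (η σ) = 0 := by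
        rw [hH, Polynomial.map_mul, Polynomial.eval_mul, hσ, zero_mul]
      rwa [hθeval] at h1
  /- Step 4: the place polynomial `P σ = R(σ^e, ·)`, `c`, `ĉ`, `D`; the order bound. -/
  have he0 : e ≠ 0 := by omega
  have hpow0 : (fun σ : ℂ => σ ^ e) 0 = 0 := by simp [zero_pow he0]
  have hQσ : ∀ j, AnalyticAt ℂ (fun σ : ℂ => Q j (σ ^ e)) 0 := fun j =>
    (hQan j).comp_of_eq (analyticAt_id.pow e) hpow0
  have hAσ : ∀ j, AnalyticAt ℂ (fun σ : ℂ => A j (σ ^ e)) 0 := fun j =>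
    (hAan j).comp_of_eq (analyticAt_id.pow e) hpow0
  have hBσ : ∀ j, AnalyticAt ℂ (fun σ : ℂ => B j (σ ^ e)) 0 := fun j =>
    (hBan j).comp_of_eq (analyticAt_id.pow e) hpow0
  have hFrσ : ∀ j, AnalyticAt ℂ (fun σ : ℂ => Fr j (σ ^ e)) 0 := fun j =>
    (hFran j).comp_of_eq (analyticAt_id.pow e) hpow0
  have hr₁σ : AnalyticAt ℂ (fun σ : ℂ => r₁ (σ ^ e)) 0 :=
    hr₁an.comp_of_eq (analyticAt_id.pow e) hpow0
  set P : ℂ → ℂ[X] := fun σ =>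
    ∑ j ∈ Finset.range (d + 1), Polynomial.C (Q j (σ ^ e)) * Polynomial.X ^ j with hP
  have hPeval : ∀ σ y, (P σ).eval y = ∑ j ∈ Finset.range (d + 1), Q j (σ ^ e) * y ^ j :=
    fun σ y => eval_rowPoly d _ y
  have hPder : ∀ σ y, (derivative (P σ)).eval y =
      ∑ j ∈ Finset.range (d + 1), (j : ℂ) * Q j (σ ^ e) * y ^ (j - 1) :=
    fun σ y => eval_derivative_rowPoly d _ y
  have hPnat : ∀ σ, (P σ).natDegree ≤ d := fun σ => natDegree_rowPoly_le d _
  have hPcoeff : ∀ σ m, (P σ).coeff m = if m < d + 1 then Q m (σ ^ e) else 0 :=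
    fun σ m => coeff_rowPoly d _ m
  have hcoefan : ∀ m, AnalyticAt ℂ (fun σ => (P σ).coeff m) 0 := by
    intro m
    by_cases hm : m < d + 1
    · simp only [hPcoeff, hm, if_true]; exact hQσ m
    · simp only [hPcoeff, hm, if_false]; exact analyticAt_const
  set c : ℂ → ℂ := fun σ => (P σ).eval (z σ) with hc
  set ĉ : ℂ → ℂ := fun σ => ∑ j ∈ Finset.range d, Fr j (σ ^ e) * z σ ^ j with hĉ
  have hĉan : AnalyticAt ℂ ĉ 0 :=
    Finset.analyticAt_fun_sum _ fun j _ => (hFrσ j).mul (hzan.pow j)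
  have hcĉ : ∀ᶠ σ in 𝓝 (0 : ℂ), c σ = σ ^ (e * N) * ĉ σ := by
    filter_upwards [hR₀z] with σ hσ
    simp only [hc, hĉ]
    rw [hPeval, hRsplit, hσ, zero_add, pow_mul]
  set D : ℂ → ℂ := fun σ => (derivative (P σ)).eval (z σ) with hD
  have hDan : AnalyticAt ℂ D 0 := by
    have h1 : D = fun σ => ∑ j ∈ Finset.range (d + 1), (j : ℂ) * Q j (σ ^ e) * z σ ^ (j - 1) :=
      funext fun σ => hPder σ _
    rw [h1]
    exact Finset.analyticAt_fun_sum _ fun j _ => (analyticAt_const.mul (hQσ j)).mul (hzan.pow _)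
  set α : ℂ → ℂ := fun σ => ∑ i ∈ Finset.range (dA + 1), A i (σ ^ e) * z σ ^ i with hα
  set β : ℂ → ℂ := fun σ => ∑ i ∈ Finset.range (dA + 1), B i (σ ^ e) * z σ ^ i with hβ
  have hαan : AnalyticAt ℂ α 0 :=
    Finset.analyticAt_fun_sum _ fun i _ => (hAσ i).mul (hzan.pow i)
  have hβan : AnalyticAt ℂ β 0 :=
    Finset.analyticAt_fun_sum _ fun i _ => (hBσ i).mul (hzan.pow i)
  -- the Bézout identity along `σ` (`σ ↦ σ^e` preserves the punctured neighbourhood of `0`;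
  -- cf. `tendsto_pow_nhdsNE_zero` of file LXXXIX, not imported here)
  have hpowT : Tendsto (fun σ : ℂ => σ ^ e) (𝓝[≠] (0 : ℂ)) (𝓝[≠] (0 : ℂ)) :=
    tendsto_nhdsWithin_iff.2 ⟨(tendsto_pow_nhds_zero e he).mono_left nhdsWithin_le_nhds,
      eventually_nhdsWithin_of_forall fun σ hσ => pow_ne_zero _ hσ⟩
  have hbezσ : ∀ᶠ σ in 𝓝[≠] (0 : ℂ), α σ * c σ + β σ * D σ = r (σ ^ e) := by
    filter_upwards [hpowT.eventually hbez] with σ hσ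
    simp only [hα, hβ, hc, hD]
    rw [hPeval, hPder]
    exact hσ (z σ)
  have hrσ : ∀ᶠ σ in 𝓝 (0 : ℂ), r (σ ^ e) = σ ^ (e * ρ) * r₁ (σ ^ e) := by
    filter_upwards [(tendsto_pow_nhds_zero e he).eventually hrfac] with σ hσ
    rw [hσ, pow_mul]
  have hrel : ∀ᶠ σ in 𝓝[≠] (0 : ℂ),
      α σ * (σ ^ (e * N) * ĉ σ) + β σ * D σ = σ ^ (e * ρ) * r₁ (σ ^ e) := by
    filter_upwards [hbezσ, nhdsWithin_le_nhds hcĉ, nhdsWithin_le_nhds hrσ] with σ h1 h2 h3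
    rw [← h2, h1, h3]
  have hρN : e * ρ < e * N := (Nat.mul_lt_mul_left (by omega)).2 (by omega)
  obtain ⟨a, D₁, ha, hD₁an, hD₁0, hDfac⟩ :=
    exists_pow_mul_le_of_relation hαan hĉan hβan hDan hr₁σ
      (by show r₁ (0 ^ e) ≠ 0; rw [zero_pow he0]; exact hr₁0) hρN hrel
  /- Step 5: `c = D²·σ·c₂` with `c₂` analytic. -/
  have h2a : 2 * a + 1 ≤ e * N := by
    have h1 : e * N = 2 * (e * ρ) + e := by rw [hN]; ring
    omega
  set c₂ : ℂ → ℂ := fun σ => σ ^ (e * N - (2 * a + 1)) * ĉ σ / D₁ σ ^ 2 with hc₂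
  have hc₂an : AnalyticAt ℂ c₂ 0 :=
    ((analyticAt_id.pow _).mul hĉan).div (hD₁an.pow 2) (pow_ne_zero _ hD₁0)
  have hD₁ne : ∀ᶠ σ in 𝓝 (0 : ℂ), D₁ σ ≠ 0 := hD₁an.continuousAt.eventually_ne hD₁0
  have hcD : ∀ᶠ σ in 𝓝 (0 : ℂ), c σ = D σ ^ 2 * σ * c₂ σ := by
    filter_upwards [hcĉ, hDfac, hD₁ne] with σ h1 h2 h3
    have hpow : σ ^ (e * N) = (σ ^ a) ^ 2 * σ * σ ^ (e * N - (2 * a + 1)) := by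
      rw [← pow_mul, ← pow_succ, ← pow_add]
      congr 1
      omega
    rw [h1, h2, hc₂, hpow]
    field_simp
  /- Step 6: Taylor rows in `w` and the bracket. -/
  set T : ℕ → ℂ → ℂ := fun i σ => (hasseDeriv i (P σ)).eval (z σ) with hT
  have hTan : ∀ i, AnalyticAt ℂ (T i) 0 := by
    intro i
    have h1 : T i = fun σ => ∑ n ∈ Finset.range (d + 1),
        ((n + i).choose i : ℂ) * (P σ).coeff (n + i) * z σ ^ n :=
      funext fun σ => eval_hasseDeriv_eq_sum (hPnat σ) i (z σ)
    rw [h1]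
    exact Finset.analyticAt_fun_sum _ fun n _ => (analyticAt_const.mul (hcoefan _)).mul (hzan.pow n)
  have hT0 : ∀ σ, T 0 σ = c σ := fun σ => by simp only [hT, hc, Polynomial.hasseDeriv_zero']
  have hT1 : ∀ σ, T 1 σ = D σ := fun σ => by simp only [hT, hD, Polynomial.hasseDeriv_one']
  have hTaylor : ∀ σ v, (P σ).eval (z σ + v) = ∑ i ∈ Finset.range (d + 1), T i σ * v ^ i :=
    fun σ v => eval_add_eq_sum_hasseDeriv (hPnat σ) (z σ) v
  set b : ℕ → ℂ → ℂ := fun i σ => match i with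
    | 0 => c₂ σ
    | 1 => 1
    | k + 2 => T (k + 2) σ * D σ ^ k * σ ^ (k + 1) with hb
  have hb0 : ∀ σ, b 0 σ = c₂ σ := fun σ => rfl
  have hb1 : ∀ σ, b 1 σ = 1 := fun σ => rfl
  have hb2 : ∀ k σ, b (k + 2) σ = T (k + 2) σ * D σ ^ k * σ ^ (k + 1) := fun k σ => rfl
  have hban : ∀ i, AnalyticAt ℂ (b i) 0 := by
    intro i
    rcases i with _ | _ | k
    · exact hc₂an
    · exact analyticAt_const
    · exact ((hTan _).mul (hDan.pow k)).mul (analyticAt_id.pow (k + 1))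
  obtain ⟨d', rfl⟩ : ∃ d', d = d' + 1 := ⟨d - 1, by omega⟩
  have hsum0 : ∀ y : ℂ, ∑ i ∈ Finset.range (d' + 1 + 1), b i 0 * y ^ i = c₂ 0 + y := by
    intro y
    rw [Finset.sum_range_succ', Finset.sum_range_succ']
    simp only [hb2, hb1, hb0, zero_pow (Nat.succ_ne_zero _), mul_zero, zero_mul,
      Finset.sum_const_zero, zero_add, pow_one, one_mul, pow_zero, mul_one]
    ring
  have hroot : ∑ i ∈ Finset.range (d' + 1 + 1), b i 0 * (-c₂ 0) ^ i = 0 := by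
    rw [hsum0]; ring
  have hsimple : ∑ i ∈ Finset.range (d' + 1 + 1), (i : ℂ) * b i 0 * (-c₂ 0) ^ (i - 1) ≠ 0 := by
    rw [Finset.sum_range_succ', Finset.sum_range_succ']
    simp only [hb2, hb1, hb0, zero_pow (Nat.succ_ne_zero _), mul_zero, zero_mul,
      Finset.sum_const_zero, zero_add, Nat.cast_zero, Nat.cast_succ, mul_one]
    norm_num
  obtain ⟨u, huan, -, huroot⟩ := exists_analytic_root_of_simple (d' + 1) b hban hroot hsimple
  /- Step 7: the root `w = z + D·σ·u`. -/
  refine ⟨e, fun σ => z σ + D σ * σ * u σ, he, hzan.add ((hDan.mul analyticAt_id).mul huan), ?_⟩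
  have hkey : ∀ σ y : ℂ, ∑ i ∈ Finset.range (d' + 1 + 1), T i σ * (D σ * σ * y) ^ i =
      c σ - D σ ^ 2 * σ * c₂ σ + D σ ^ 2 * σ * ∑ i ∈ Finset.range (d' + 1 + 1), b i σ * y ^ i := by
    intro σ y
    have hL : ∑ i ∈ Finset.range (d' + 1 + 1), T i σ * (D σ * σ * y) ^ i =
        ∑ i ∈ Finset.range d', T (i + 1 + 1) σ * (D σ * σ * y) ^ (i + 1 + 1) +
          T (0 + 1) σ * (D σ * σ * y) ^ (0 + 1) + T 0 σ * (D σ * σ * y) ^ 0 := by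
      rw [Finset.sum_range_succ', Finset.sum_range_succ']
    have hR : ∑ i ∈ Finset.range (d' + 1 + 1), b i σ * y ^ i =
        ∑ i ∈ Finset.range d', b (i + 1 + 1) σ * y ^ (i + 1 + 1) + b (0 + 1) σ * y ^ (0 + 1) +
          b 0 σ * y ^ 0 := by
      rw [Finset.sum_range_succ', Finset.sum_range_succ']
    rw [hL, hR]
    simp only [zero_add, hT0, hT1, hb0, hb1, hb2, pow_zero, mul_one, pow_one]
    rw [mul_add, mul_add, Finset.mul_sum]
    have h1 : ∀ i ∈ Finset.range d', T (i + 1 + 1) σ * (D σ * σ * y) ^ (i + 1 + 1) =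
        D σ ^ 2 * σ * (T (i + 2) σ * D σ ^ i * σ ^ (i + 1) * y ^ (i + 1 + 1)) := by
      intro i _
      ring
    rw [Finset.sum_congr rfl h1]
    ring
  filter_upwards [hcD, huroot] with σ h1 h2
  rw [← hPeval, hTaylor, hkey, h2, h1]
  ring

end Summit.Schanuel.Schanuel.Theorems
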